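import Literature.NumberTheory.ConnesConsani2021.ScalingOperator
import Mathlib.Analysis.Fourier.RiemannLebesgueLemma
import Literature.NumberTheory.DiophantineApproximation.FloorMultiples
import HarnessLib

/-!
# Riemann–Lebesgue for the scaling representation: matrix coefficients of `ϑ(h)` between OPPOSITELY or
# EQUALLY modulated vectors `e^{2πiaMx} ψ`, `e^{2πibMx} φ` (`b ≠ 0`) tend to `0` as `M → ∞`

LABEL (line 1): RH-FREE literature (theorems only; NO definition, NO named fact).  bears_on: LADDER-RH
W-C/W-P (C1 named-fact debt), cell `rh-crit`, sub-cell cc, overflow row O1 — step (iv-c) of the separated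
remainder estimate (S2) of the "annulus road" under `Connes1999_thm_VII_4_rat`: after the rank-one expansion of
the separated sinc operator `(1 − Q̃) P̂⁰_M Q₀` every term of the trace is such a matrix coefficient.  WHAT THIS
IS NOT: any claim about positivity, Weil's criterion or RH.

Sources.  A. Connes, C. Consani, Selecta Math. 27 (2021) [`ConnesConsani2021`], Prop. 2.2 (iii) p. 10 and §4
eq. (40) p. 15 (`ϑ(f) = ∫ f(λ) ϑ(λ) d^*λ`, `(ϑ(λ)ξ)(v) = λ^{−1/2} ξ(λ^{−1} v)`); the Riemann–Lebesgue lemma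
(Mathlib `Real.tendsto_integral_exp_smul_cocompact`); A. Connes, Selecta Math. 5 (1999) [`Connes1999`], §VII
proof of Thm 4 (29)–(33).

## What is proved

* `tendsto_integral_cexp_mul_atTop` — `∫ e^{2πi cMx} F(x) dx → 0` as `M → ∞` for `c ≠ 0` (any `F`);
* `inner_scalingUnitary_modulated` — `⟨e^{2πiaM·}ψ, ϑ(e^τ)(e^{2πibM·}φ)⟩ = ∫ e^{2πi(be^{−τ} − a)Mx} conj ψ(x) e^{−τ/2} φ(e^{−τ}x) dx`;
* **`tendsto_inner_scalingOp_modulated`** — for `ψ, φ ∈ L²(ℝ)`, `h ∈ L¹(ℝ)`, `a ∈ ℝ`, `b ≠ 0` and any families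
  `Ψ_M = e^{2πiaM·}ψ`, `Φ_M = e^{2πibM·}φ` (a.e.), `⟨Ψ_M, ϑ(h) Φ_M⟩ → 0` as `M → ∞` (dominated convergence in `τ`:
  for `τ` off the at most one-point set `{be^{−τ} = a}` the coefficient tends to `0` by Riemann–Lebesgue).

No instance, notation or attribute; no `def`.
-/

noncomputable section

open _root_.MeasureTheory Complex Set Filter
open scoped Real Topology ComplexConjugate InnerProductSpace FourierTransform

namespace Literature.NumberTheory.Connes2026

open Literature.NumberTheory.LFunctions Literature.Analysis.OperatorTheory
open Literature.NumberTheory.ConnesConsani2021 Literature.NumberTheory.DiophantineApproximation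

/-! ## §1. Scalar Riemann–Lebesgue in the form used here -/

/-- **`∫ e^{2πi c M x} F(x) dx → 0` as `M → +∞`** for `c ≠ 0` (Riemann–Lebesgue; for non-integrable `F` the
integral is identically `0`). [cite: Connes1999, §VII proof of Thm 4 eqs. (29)–(33) (arXiv p0013)] -/
theorem tendsto_integral_cexp_mul_atTop (F : ℝ → ℂ) {c : ℝ} (hc : c ≠ 0) :
    Tendsto (fun M : ℝ => ∫ x : ℝ, cexp (2 * π * I * ((c * M * x : ℝ) : ℂ)) * F x) atTop (𝓝 0) := by
  have h := Real.tendsto_integral_exp_smul_cocompact F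
  have hw : Tendsto (fun M : ℝ => -c * M) atTop (cocompact ℝ) := by
    rcases lt_or_gt_of_ne hc with hc' | hc'
    · exact (Tendsto.const_mul_atTop (by linarith : 0 < -c) tendsto_id).mono_right atTop_le_cocompact
    · exact (Tendsto.const_mul_atTop_of_neg (by linarith : -c < 0) tendsto_id).mono_right atBot_le_cocompact
  refine (h.comp hw).congr fun M => ?_
  simp only [Function.comp]
  refine integral_congr_ae (ae_of_all _ fun v => ?_)
  change 𝐞 (-(v * (-c * M))) • F v = cexp (2 * π * I * ((c * M * v : ℝ) : ℂ)) * F v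
  rw [Circle.smul_def, Real.fourierChar_apply]
  congr 1
  congr 1
  push_cast
  ring

/-- `conj e^{2πi t} = e^{−2πi t}`. [cite: Connes1999, §VII proof of Thm 4 eqs. (29)–(33) (arXiv p0013)] -/
theorem conj_cexp_two_pi_I_mul (t : ℝ) : conj (cexp (2 * π * I * (t : ℂ))) = cexp (2 * π * I * ((-t : ℝ) : ℂ)) := by
  rw [← Complex.exp_conj]
  congr 1
  simp only [map_mul, Complex.conj_ofReal, Complex.conj_I, map_ofNat]
  push_cast
  ring

/-! ## §2. The `L²` norm of a modulated function -/

/-- A modulated `L²` function is in `L²` with the same norm profile. [cite: Connes1999, §VII proof of Thm 4 eqs. (29)–(33) (arXiv p0013)] -/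
theorem memLp_cexp_mul {ψ : ℝ → ℂ} (hψ : MemLp ψ 2 (volume : Measure ℝ)) (c : ℝ) :
    MemLp (fun x : ℝ => cexp (2 * π * I * ((c * x : ℝ) : ℂ)) * ψ x) 2 (volume : Measure ℝ) := by
  refine hψ.of_le ?_ (ae_of_all _ fun x => ?_)
  · exact ((Complex.continuous_exp.comp (continuous_const.mul (Complex.continuous_ofReal.comp
      (continuous_const.mul continuous_id)))).aestronglyMeasurable).mul hψ.1
  · rw [norm_mul, FloorMulEquidist.norm_e, one_mul]

/-- If `Ψ =ᵐ e^{2πi c ·} ψ` then `‖Ψ‖_{L²} = ‖ψ‖_{L²}`. [cite: Connes1999, §VII proof of Thm 4 eqs. (29)–(33) (arXiv p0013)] -/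
theorem norm_eq_of_ae_eq_cexp_mul {ψ : ℝ → ℂ} (hψ : MemLp ψ 2 (volume : Measure ℝ)) (c : ℝ)
    {Ψ : Lp ℂ 2 (volume : Measure ℝ)} (hΨ : (Ψ : ℝ → ℂ) =ᵐ[volume] fun x => cexp (2 * π * I * ((c * x : ℝ) : ℂ)) * ψ x) :
    ‖Ψ‖ = ‖hψ.toLp ψ‖ := by
  rw [Lp.norm_def, Lp.norm_toLp, eLpNorm_congr_ae hΨ]
  congr 1
  refine eLpNorm_congr_norm_ae (ae_of_all _ fun x => ?_)
  rw [norm_mul, FloorMulEquidist.norm_e, one_mul]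

/-! ## §3. The matrix coefficient of one dilation between modulated vectors -/

/-- **`⟨e^{2πiaM·}ψ, ϑ(e^τ)(e^{2πibM·}φ)⟩ = ∫ e^{2πi(be^{−τ} − a)Mx} conj ψ(x) e^{−τ/2} φ(e^{−τ}x) dx`**:
a dilation turns the modulation `e^{2πibMy}` into `e^{2πibMe^{−τ}x}`. [cite: ConnesConsani2021, §4 eq. (40) p. 15] -/
theorem inner_scalingUnitary_modulated {ψ φ : ℝ → ℂ} {a b M : ℝ} (τ : ℝ)
    {Ψ Φ : Lp ℂ 2 (volume : Measure ℝ)}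
    (hΨ : (Ψ : ℝ → ℂ) =ᵐ[volume] fun x => cexp (2 * π * I * ((a * M * x : ℝ) : ℂ)) * ψ x)
    (hΦ : (Φ : ℝ → ℂ) =ᵐ[volume] fun x => cexp (2 * π * I * ((b * M * x : ℝ) : ℂ)) * φ x) :
    ⟪Ψ, scalingUnitary τ Φ⟫_ℂ =
      ∫ x : ℝ, cexp (2 * π * I * (((b * Real.exp (-τ) - a) * M * x : ℝ) : ℂ)) *
        (conj (ψ x) * ((Real.exp (-τ / 2) : ℂ) * φ (Real.exp (-τ) * x))) := by
  rw [L2.inner_def]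
  have h1 := scalingUnitary_coeFn τ Φ
  have h2 : (fun x : ℝ => (Φ : ℝ → ℂ) (Real.exp (-τ) * x)) =ᵐ[volume]
      fun x => cexp (2 * π * I * ((b * M * (Real.exp (-τ) * x) : ℝ) : ℂ)) * φ (Real.exp (-τ) * x) := by
    have := ae_eq_comp_smul (V := ℝ) hΦ (Real.exp_pos (-τ)).ne'
    simpa only [smul_eq_mul] using this
  refine integral_congr_ae ?_
  filter_upwards [hΨ, h1, h2] with x ex e1 e2
  rw [RCLike.inner_apply', ex, e1, e2, map_mul, conj_cexp_two_pi_I_mul]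
  have hexp : cexp (2 * π * I * ((-(a * M * x) : ℝ) : ℂ)) * cexp (2 * π * I * ((b * M * (Real.exp (-τ) * x) : ℝ) : ℂ)) =
      cexp (2 * π * I * (((b * Real.exp (-τ) - a) * M * x : ℝ) : ℂ)) := by
    rw [← Complex.exp_add]
    congr 1
    push_cast
    ring
  calc cexp (2 * π * I * ((-(a * M * x) : ℝ) : ℂ)) * conj (ψ x) *
        ((Real.exp (-τ / 2) : ℂ) * (cexp (2 * π * I * ((b * M * (Real.exp (-τ) * x) : ℝ) : ℂ)) * φ (Real.exp (-τ) * x)))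
      = (cexp (2 * π * I * ((-(a * M * x) : ℝ) : ℂ)) * cexp (2 * π * I * ((b * M * (Real.exp (-τ) * x) : ℝ) : ℂ))) *
          (conj (ψ x) * ((Real.exp (-τ / 2) : ℂ) * φ (Real.exp (-τ) * x))) := by ring
    _ = _ := by rw [hexp]

/-! ## §4. The matrix coefficient of `ϑ(h)` between modulated vectors tends to `0` -/

/-- **Riemann–Lebesgue for `ϑ(h)`**: for `ψ, φ ∈ L²(ℝ)`, `h ∈ L¹(ℝ)`, `a ∈ ℝ`, `b ≠ 0`, and families
`Ψ_M =ᵐ e^{2πiaM·} ψ`, `Φ_M =ᵐ e^{2πibM·} φ`: `⟨Ψ_M, ϑ(h) Φ_M⟩ → 0` as `M → +∞`.  Proof: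
`⟨Ψ_M, ϑ(h)Φ_M⟩ = ∫ h(τ) ⟨Ψ_M, ϑ(e^τ)Φ_M⟩ dτ`; for `τ` with `be^{−τ} ≠ a` (all but at most one `τ`) the
coefficient is `∫ e^{2πi(be^{−τ}−a)Mx} (…) dx → 0` by Riemann–Lebesgue, and `|h(τ)| ‖ψ‖ ‖φ‖` dominates. [cite: ConnesConsani2021, Prop. 2.2 (iii) p. 10; Connes1999, §VII proof of Thm 4 eqs. (29)–(33) (arXiv p0013)] -/
theorem tendsto_inner_scalingOp_modulated {ψ φ : ℝ → ℂ} (hψ : MemLp ψ 2 (volume : Measure ℝ))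
    (hφ : MemLp φ 2 (volume : Measure ℝ)) {h : ℝ → ℂ} (hh : Integrable h) {a b : ℝ} (hb : b ≠ 0)
    {Ψ Φ : ℝ → Lp ℂ 2 (volume : Measure ℝ)}
    (hΨ : ∀ M, (Ψ M : ℝ → ℂ) =ᵐ[volume] fun x => cexp (2 * π * I * ((a * M * x : ℝ) : ℂ)) * ψ x)
    (hΦ : ∀ M, (Φ M : ℝ → ℂ) =ᵐ[volume] fun x => cexp (2 * π * I * ((b * M * x : ℝ) : ℂ)) * φ x) :
    Tendsto (fun M : ℝ => ⟪Ψ M, scalingOp h (Φ M)⟫_ℂ) atTop (𝓝 0) := by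
  -- norms of the modulated families
  have hnΨ : ∀ M, ‖Ψ M‖ = ‖hψ.toLp ψ‖ := fun M =>
    norm_eq_of_ae_eq_cexp_mul hψ (a * M) ((hΨ M).trans (ae_of_all _ fun x => by ring_nf))
  have hnΦ : ∀ M, ‖Φ M‖ = ‖hφ.toLp φ‖ := fun M =>
    norm_eq_of_ae_eq_cexp_mul hφ (b * M) ((hΦ M).trans (ae_of_all _ fun x => by ring_nf))
  -- the integral representation
  have hrep : ∀ M, ⟪Ψ M, scalingOp h (Φ M)⟫_ℂ = ∫ τ, h τ * ⟪Ψ M, scalingUnitary τ (Φ M)⟫_ℂ := fun M => by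
    rw [inner_scalingOp hh]
    simp_rw [scalingCoeff_eq_inner_scalingUnitary]
  simp_rw [hrep]
  -- the exceptional set `{τ | b e^{−τ} = a}` is at most a point
  have hnull : ∀ᵐ τ : ℝ, b * Real.exp (-τ) - a ≠ 0 := by
    have hsub : ({τ : ℝ | b * Real.exp (-τ) - a = 0} : Set ℝ).Subsingleton := by
      intro τ₁ h₁ τ₂ h₂
      simp only [Set.mem_setOf_eq, sub_eq_zero] at h₁ h₂
      have h12 : Real.exp (-τ₁) = Real.exp (-τ₂) := mul_left_cancel₀ hb (h₁.trans h₂.symm)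
      have := Real.exp_injective h12
      linarith
    have h0 : volume ({τ : ℝ | b * Real.exp (-τ) - a = 0} : Set ℝ) = 0 := hsub.measure_zero _
    rw [ae_iff]
    simpa only [ne_eq, not_not] using h0
  -- pointwise limit off the exceptional set
  have hlim : ∀ᵐ τ : ℝ, Tendsto (fun M : ℝ => h τ * ⟪Ψ M, scalingUnitary τ (Φ M)⟫_ℂ) atTop (𝓝 0) := by
    filter_upwards [hnull] with τ hτ
    have h1 : Tendsto (fun M : ℝ => ⟪Ψ M, scalingUnitary τ (Φ M)⟫_ℂ) atTop (𝓝 0) := by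
      have hc := tendsto_integral_cexp_mul_atTop
        (fun x : ℝ => conj (ψ x) * ((Real.exp (-τ / 2) : ℂ) * φ (Real.exp (-τ) * x))) hτ
      refine hc.congr fun M => ?_
      exact (inner_scalingUnitary_modulated τ (hΨ M) (hΦ M)).symm
    simpa only [mul_zero] using h1.const_mul (h τ)
  -- dominated convergence in `τ`
  have hgoal := tendsto_integral_filter_of_dominated_convergence
    (F := fun (M : ℝ) (τ : ℝ) => h τ * ⟪Ψ M, scalingUnitary τ (Φ M)⟫_ℂ) (f := fun _ => (0 : ℂ))
    (bound := fun τ => ‖h τ‖ * (‖hψ.toLp ψ‖ * ‖hφ.toLp φ‖)) ?_ ?_ ?_ hlim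
  · simpa only [integral_zero] using hgoal
  · exact Eventually.of_forall fun M =>
      hh.aestronglyMeasurable.mul
        (continuous_const.inner (continuous_scalingUnitary_apply (Φ M))).aestronglyMeasurable
  · refine Eventually.of_forall fun M => ae_of_all _ fun τ => ?_
    rw [norm_mul]
    refine mul_le_mul_of_nonneg_left ?_ (norm_nonneg _)
    calc ‖⟪Ψ M, scalingUnitary τ (Φ M)⟫_ℂ‖ ≤ ‖Ψ M‖ * ‖scalingUnitary τ (Φ M)‖ := norm_inner_le_norm _ _
      _ = ‖hψ.toLp ψ‖ * ‖hφ.toLp φ‖ := by rw [norm_scalingUnitary_apply, hnΨ, hnΦ]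
  · exact hh.norm.mul_const _

end Literature.NumberTheory.Connes2026
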